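import Summits.QuantumFields.YangMills.Theorems.UniversalDetectorLaplaceInjective
import Literature.MathematicalPhysics.QuantumLattice.EuclideanAction
import Literature.Analysis.FunctionSpaces.GaussianSchwartz

/-!
# Route `UniversalDetector`, crux `DetectorRigidity` (stmt-QuantumFields-26595) — stub 2 of the birth skeleton, proved

Ideator seat ym-idea-8 g4, LINE 4 of rung R2a (bonus de-risking of the universal-detector lever while the g4 «dual»
survey of `BalabanLadder.NT` found nothing new at route level). The GAUSSIAN DECONVOLUTION step of the skeleton
(`bc/DetectorRigidity_birth.lean`, `Stmt_gaussDeconv`, verbatim): a kernel `K : ℝ⁴ → ℝ`, continuous off the origin and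
bounded away from it, which is `L²`-orthogonal — in the reflection-positivity pairing
`∫∫ (Θ w₁)(x) w₂(y) K(y - x)` — to every pair (time-profile × Gaussian test function `w₁ = h(y₀) e^{-‖y‖²}` supported at
positive times, Schwartz function `w₂` supported in a positive time slab) vanishes on the open half-space `{z₀ > 0}`.

Proof.  (A) Fubini + the smooth-compact-support density lemma
(`IsOpen.ae_eq_zero_of_integral_contDiff_smul_eq_zero`) and continuity of `Ψ(y) = ∫ (Θw₁)(x) K(y-x) dx` on `{y₀ > 0}`
give `Ψ ≡ 0` there.  (B) Choosing the time profile `h = b · e^{-(2τ - v₀)(t+τ)}` (`b` a `ContDiffBump`) and the point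
`y_v = ½(v - v₀ e₀) + τ e₀`, the Gaussian completes the square and `Ψ(y_v) = e^{-‖y_v‖²} ∫ e^{⟪v,u⟫} ρ(u) du` with
`ρ(u) = b(u₀ - τ) e^{-‖u‖²} K(u)`; so every real exponential moment of `ρ` vanishes.  (C) Two-sided Laplace
injectivity (`eq_zero_of_laplace_eq_zero`: `ρ^±` have equal MGFs, Mathlib's analytic continuation
`ProbabilityTheory.eqOn_complexMGF_of_mgf'` to `z = I`, then Fourier inversion at a continuity point) gives `ρ(z) = 0`,
i.e. `K z = 0` since `b(z₀ - τ) = 1`.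
With `Stmt_semigroupKill` (XL, OS semigroup — the one remaining stub) and `symmetrySpread` (landed) this composes to the
crux by `DetectorRigidity_of`; no summit, leg or spine crux is proved here.
-/

set_option autoImplicit false

noncomputable section

open MeasureTheory ProbabilityTheory Complex Filter Set
open scoped RealInnerProductSpace FourierTransform ENNReal ContDiff
open Literature.MathematicalPhysics.QuantumLattice Literature.Analysis.FunctionSpaces

namespace Summit.QuantumFields.YangMills.Cruxes.DetectorRigidity

/-- `|u 0| ≤ ‖u‖` on `ℝ⁴`. -/
private theorem abs_coord_le_norm (u : EuclideanSpace ℝ (Fin 4)) : |u 0| ≤ ‖u‖ := by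
  have h := abs_real_inner_le_norm (EuclideanSpace.single (0 : Fin 4) (1 : ℝ)) u
  rw [EuclideanSpace.inner_single_left] at h
  simpa using h

/-- The time coordinate `y ↦ y 0` is continuous on `ℝ⁴`. -/
private theorem continuous_coord : Continuous fun y : EuclideanSpace ℝ (Fin 4) => y 0 :=
  (EuclideanSpace.proj (0 : Fin 4) : EuclideanSpace ℝ (Fin 4) →L[ℝ] ℝ).continuous

/-- **Stub 2 (`Stmt_gaussDeconv`) of the `DetectorRigidity` skeleton, proved.** -/
theorem gaussDeconv :
    ∀ (K : EuclideanSpace ℝ (Fin 4) → ℝ),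
      ContinuousOn K {z | z ≠ 0} →
      (∀ η : ℝ, 0 < η → ∃ C : ℝ, ∀ z : EuclideanSpace ℝ (Fin 4), η ≤ ‖z‖ → |K z| ≤ C) →
      (∀ (w₁ w₂ : SchwartzMap (EuclideanSpace ℝ (Fin 4)) ℝ) (h₁ : ℝ → ℝ) (t₁ T₁ t₂ T₂ : ℝ),
        0 < t₁ → Continuous h₁ → tsupport h₁ ⊆ Set.Icc t₁ T₁ →
        (∀ y, w₁ y = h₁ (y 0) * Real.exp (-‖y‖ ^ 2)) → 0 < t₂ →
        tsupport (w₂ : EuclideanSpace ℝ (Fin 4) → ℝ) ⊆ {y | t₂ ≤ y 0 ∧ y 0 ≤ T₂} →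
        (∫ x, ∫ y, (thetaTest 4 w₁) x * w₂ y * K (y - x)) = 0) →
      ∀ z : EuclideanSpace ℝ (Fin 4), 0 < z 0 → K z = 0 := by
  intro K hK hB H z hz
  -- constants -------------------------------------------------------------------------------
  set τ : ℝ := z 0 / 3 with hτ_def
  have hτ : 0 < τ := by positivity
  obtain ⟨C, hC⟩ := hB (z 0 / 3) (by positivity)
  set C' : ℝ := max C 0 with hC'_def
  have hC'0 : 0 ≤ C' := le_max_right _ _
  have hKC : ∀ u : EuclideanSpace ℝ (Fin 4), z 0 / 3 ≤ ‖u‖ → |K u| ≤ C' :=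
    fun u hu => (hC u hu).trans (le_max_left _ _)
  have hKm : Measurable K := by
    refine measurable_of_continuousOn_compl_singleton 0 ?_
    rw [compl_singleton_eq]; exact hK
  -- the bump in the time variable ------------------------------------------------------------
  let b : ContDiffBump (2 * z 0 / 3 : ℝ) := ⟨z 0 / 6, z 0 / 3, by positivity, by linarith⟩
  have hb_tsupp : tsupport (b : ℝ → ℝ) = Icc (z 0 / 3) (z 0) := by
    rw [b.tsupport_eq, Real.closedBall_eq_Icc]
    show Icc (2 * z 0 / 3 - z 0 / 3) (2 * z 0 / 3 + z 0 / 3) = _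
    congr 1 <;> ring
  have hb_one : (b : ℝ → ℝ) (z 0 - τ) = 1 := by
    apply b.one_of_mem_closedBall
    rw [show z 0 - τ = 2 * z 0 / 3 by rw [hτ_def]; ring]
    exact Metric.mem_closedBall_self b.rIn_pos.le
  -- the support of `b (u 0 - τ)` forces `‖u‖ ≥ z 0 / 3`
  have hb_far : ∀ u : EuclideanSpace ℝ (Fin 4), (b : ℝ → ℝ) (u 0 - τ) ≠ 0 → z 0 / 3 ≤ ‖u‖ := by
    intro u hu
    have h1 : u 0 - τ ∈ tsupport (b : ℝ → ℝ) := subset_tsupport _ (Function.mem_support.mpr hu)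
    rw [hb_tsupp] at h1
    calc z 0 / 3 ≤ u 0 := by linarith [h1.1]
      _ ≤ |u 0| := le_abs_self _
      _ ≤ ‖u‖ := abs_coord_le_norm u
  -- the density `ρ` to which Laplace injectivity is applied ----------------------------------
  set ρ : EuclideanSpace ℝ (Fin 4) → ℝ :=
    fun u => (b : ℝ → ℝ) (u 0 - τ) * Real.exp (-‖u‖ ^ 2) * K u with hρ_def
  have hρm : Measurable ρ :=
    ((b.continuous.comp (continuous_coord.sub continuous_const)).measurable.mul
      (Real.continuous_exp.comp (continuous_norm.pow 2).neg).measurable).mul hKm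
  have hρ_bound : ∀ u : EuclideanSpace ℝ (Fin 4), |ρ u| ≤ C' * Real.exp (-‖u‖ ^ 2) := by
    intro u
    by_cases hu : (b : ℝ → ℝ) (u 0 - τ) = 0
    · simp [hρ_def, hu]; positivity
    · rw [hρ_def]
      simp only [abs_mul, abs_of_pos (Real.exp_pos _)]
      have h1 : |(b : ℝ → ℝ) (u 0 - τ)| ≤ 1 := by
        rw [abs_of_nonneg b.nonneg]; exact b.le_one
      have h2 : |K u| ≤ C' := hKC u (hb_far u hu)
      calc |(b : ℝ → ℝ) (u 0 - τ)| * Real.exp (-‖u‖ ^ 2) * |K u|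
          ≤ 1 * Real.exp (-‖u‖ ^ 2) * C' := by gcongr
        _ = C' * Real.exp (-‖u‖ ^ 2) := by ring
  -- integrability of all exponential tilts of `ρ`
  have hρi : ∀ v : EuclideanSpace ℝ (Fin 4), Integrable (fun u => Real.exp ⟪v, u⟫ * ρ u) := by
    intro v
    have hG : Integrable (fun u : EuclideanSpace ℝ (Fin 4) =>
        realGaussianSchwartz (EuclideanSpace ℝ (Fin 4)) 1 (u - (1 / 2 : ℝ) • v)) :=
      (realGaussianSchwartz (EuclideanSpace ℝ (Fin 4)) 1).integrable.comp_sub_right ((1 / 2 : ℝ) • v)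
    refine ((hG.const_mul (C' * Real.exp (‖(1 / 2 : ℝ) • v‖ ^ 2))).mono'
      (((Real.continuous_exp.comp (continuous_const.inner continuous_id)).measurable.mul
        hρm).aestronglyMeasurable) (Eventually.of_forall fun u => ?_))
    rw [realGaussianSchwartz_apply one_pos, norm_mul, Real.norm_eq_abs, Real.norm_eq_abs,
      abs_of_pos (Real.exp_pos _)]
    have hsq : ‖u - (1 / 2 : ℝ) • v‖ ^ 2 = ‖u‖ ^ 2 - 2 * ⟪u, (1 / 2 : ℝ) • v⟫ + ‖(1 / 2 : ℝ) • v‖ ^ 2 :=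
      norm_sub_sq_real _ _
    have hexp : Real.exp ⟪v, u⟫ * Real.exp (-‖u‖ ^ 2) =
        Real.exp (‖(1 / 2 : ℝ) • v‖ ^ 2) * Real.exp (-1 * ‖u - (1 / 2 : ℝ) • v‖ ^ 2) := by
      rw [← Real.exp_add, ← Real.exp_add]
      congr 1
      rw [hsq, real_inner_smul_right, real_inner_comm]
      ring
    calc Real.exp ⟪v, u⟫ * |ρ u| ≤ Real.exp ⟪v, u⟫ * (C' * Real.exp (-‖u‖ ^ 2)) :=
          mul_le_mul_of_nonneg_left (hρ_bound u) (Real.exp_pos _).le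
      _ = C' * (Real.exp ⟪v, u⟫ * Real.exp (-‖u‖ ^ 2)) := by ring
      _ = C' * Real.exp (‖(1 / 2 : ℝ) • v‖ ^ 2) * Real.exp (-1 * ‖u - (1 / 2 : ℝ) • v‖ ^ 2) := by
          rw [hexp]; ring
  -- continuity of `ρ` at `z`
  have hz0 : z ≠ 0 := by
    intro h; rw [h] at hz; simp at hz
  have hρc : ContinuousAt ρ z := by
    have hKz : ContinuousAt K z := hK.continuousAt (isOpen_ne.mem_nhds hz0)
    exact (((b.continuous.comp (continuous_coord.sub continuous_const)).continuousAt).mul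
      (Real.continuous_exp.comp (continuous_norm.pow 2).neg).continuousAt).mul hKz
  -- MAIN STEP: every exponential moment of `ρ` vanishes -------------------------------------
  have hlap : ∀ v : EuclideanSpace ℝ (Fin 4), ∫ u, Real.exp ⟪v, u⟫ * ρ u = 0 := by
    intro v
    -- the time profile `g` and the test function `w₁ = g(y₀) e^{-‖y‖²}`
    set g : ℝ → ℝ := fun t => (b : ℝ → ℝ) t * Real.exp (-(2 * τ - v 0) * (t + τ)) with hg_def
    have hg_cont : Continuous g :=
      b.continuous.mul (Real.continuous_exp.comp (continuous_const.mul (continuous_id.add continuous_const)))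
    have hg_smooth : ContDiff ℝ ∞ g :=
      b.contDiff.mul (Real.contDiff_exp.comp (contDiff_const.mul (contDiff_id.add contDiff_const)))
    have hg_supp : HasCompactSupport g := b.hasCompactSupport.mul_right
    have hg_tsupp : tsupport g ⊆ Icc (z 0 / 3) (z 0) := by
      rw [← hb_tsupp]; exact tsupport_mul_subset_left
    have htg : (fun y : EuclideanSpace ℝ (Fin 4) => g (y 0)).HasTemperateGrowth :=
      (hg_supp.hasTemperateGrowth hg_smooth).comp
        (EuclideanSpace.proj (0 : Fin 4) : EuclideanSpace ℝ (Fin 4) →L[ℝ] ℝ).hasTemperateGrowth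
    set w₁ : SchwartzMap (EuclideanSpace ℝ (Fin 4)) ℝ :=
      SchwartzMap.smulLeftCLM ℝ (fun y : EuclideanSpace ℝ (Fin 4) => g (y 0))
        (realGaussianSchwartz (EuclideanSpace ℝ (Fin 4)) 1) with hw₁_def
    have hw₁ : ∀ y, w₁ y = g (y 0) * Real.exp (-‖y‖ ^ 2) := by
      intro y
      rw [hw₁_def, SchwartzMap.smulLeftCLM_apply_apply htg, realGaussianSchwartz_apply one_pos,
        smul_eq_mul, neg_mul, one_mul]
    -- where `Θ w₁` lives
    have hθfar : ∀ x y : EuclideanSpace ℝ (Fin 4), thetaTest 4 w₁ x ≠ 0 → 0 < y 0 →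
        z 0 / 3 ≤ ‖y - x‖ := by
      intro x y hx hy
      rw [thetaTest_apply, hw₁] at hx
      have h1 : g ((timeReflection 4 x) 0) ≠ 0 := left_ne_zero_of_mul hx
      have h2 : (timeReflection 4 x) 0 ∈ tsupport g := subset_tsupport _ (Function.mem_support.mpr h1)
      have h3 := hg_tsupp h2
      simp [timeReflection_apply] at h3
      calc z 0 / 3 ≤ (y - x) 0 := by simp; linarith [h3.1]
        _ ≤ |(y - x) 0| := le_abs_self _
        _ ≤ ‖y - x‖ := abs_coord_le_norm _
    -- STEP A: `Ψ(y) = ∫ Θw₁(x) K(y-x) dx` vanishes on the positive half-space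
    set U : Set (EuclideanSpace ℝ (Fin 4)) := {y | 0 < y 0} with hU_def
    have hU : IsOpen U := isOpen_lt continuous_const continuous_coord
    set Ψ : EuclideanSpace ℝ (Fin 4) → ℝ := fun y => ∫ x, thetaTest 4 w₁ x * K (y - x) with hΨ_def
    have hΨc : ContinuousOn Ψ U := by
      intro y₀ hy₀
      apply ContinuousAt.continuousWithinAt
      apply continuousAt_of_dominated (bound := fun x => C' * ‖thetaTest 4 w₁ x‖)
      · exact Eventually.of_forall fun y =>
          ((thetaTest 4 w₁).continuous.measurable.mul
            (hKm.comp (measurable_const.sub measurable_id))).aestronglyMeasurable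
      · filter_upwards [hU.mem_nhds hy₀] with y hy
        refine Eventually.of_forall fun x => ?_
        by_cases hx : thetaTest 4 w₁ x = 0
        · simp [hx]
        · rw [norm_mul, mul_comm]
          refine mul_le_mul_of_nonneg_right ?_ (norm_nonneg _)
          rw [Real.norm_eq_abs]; exact hKC (y - x) (hθfar x y hx hy)
      · exact (thetaTest 4 w₁).integrable.norm.const_mul C'
      · refine Eventually.of_forall fun x => ?_
        by_cases hx : thetaTest 4 w₁ x = 0
        · simp only [hx, zero_mul]; exact continuousAt_const
        · have hne : y₀ - x ≠ 0 := by
            intro h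
            have := hθfar x y₀ hx hy₀
            rw [h, norm_zero] at this
            linarith
          have hKat : ContinuousAt K (y₀ - x) := hK.continuousAt (isOpen_ne.mem_nhds hne)
          exact continuousAt_const.mul
            (ContinuousAt.comp_of_eq hKat (continuousAt_id.sub continuousAt_const) rfl)
    have hΨint : ∀ φ : EuclideanSpace ℝ (Fin 4) → ℝ, ContDiff ℝ ∞ φ → HasCompactSupport φ →
        tsupport φ ⊆ U → ∫ y, φ y • Ψ y = 0 := by
      intro φ hφd hφc hφU
      by_cases hφ0 : tsupport φ = ∅
      · have : φ = 0 := tsupport_eq_empty_iff.mp hφ0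
        simp [this]
      obtain ⟨ym, hym, hmin⟩ :=
        hφc.exists_isMinOn (nonempty_iff_ne_empty.mpr hφ0) continuous_coord.continuousOn
      obtain ⟨yM, hyM, hmax⟩ :=
        hφc.exists_isMaxOn (nonempty_iff_ne_empty.mpr hφ0) continuous_coord.continuousOn
      have ht₂ : 0 < ym 0 := hφU hym
      have hsub : tsupport φ ⊆ {y : EuclideanSpace ℝ (Fin 4) | ym 0 ≤ y 0 ∧ y 0 ≤ yM 0} :=
        fun y hy => ⟨hmin hy, hmax hy⟩
      let φS : SchwartzMap (EuclideanSpace ℝ (Fin 4)) ℝ := hφc.toSchwartzMap hφd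
      have hφS : ∀ y, φS y = φ y := fun _ => rfl
      have hH := H w₁ φS g (z 0 / 3) (z 0) (ym 0) (yM 0) (by positivity) hg_cont hg_tsupp hw₁ ht₂
        (by exact hsub)
      have hφi : Integrable φ := hφd.continuous.integrable_of_hasCompactSupport hφc
      -- Fubini
      have hF : Integrable (Function.uncurry fun x y => thetaTest 4 w₁ x * φS y * K (y - x))
          ((volume : Measure (EuclideanSpace ℝ (Fin 4))).prod volume) := by
        refine (((thetaTest 4 w₁).integrable.norm.mul_prod hφi.norm).const_mul C').mono' ?_ ?_
        · exact ((((thetaTest 4 w₁).continuous.measurable.comp measurable_fst).mul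
            (hφd.continuous.measurable.comp measurable_snd)).mul
            (hKm.comp (measurable_snd.sub measurable_fst))).aestronglyMeasurable
        · refine Eventually.of_forall fun p => ?_
          rcases p with ⟨x, y⟩
          simp only [Function.uncurry_apply_pair, hφS]
          by_cases hx : thetaTest 4 w₁ x = 0
          · simp [hx]
          by_cases hy : φ y = 0
          · simp [hy]
          have hyU : 0 < y 0 := hφU (subset_tsupport _ (Function.mem_support.mpr hy))
          rw [norm_mul, norm_mul]
          calc ‖thetaTest 4 w₁ x‖ * ‖φ y‖ * ‖K (y - x)‖ ≤ ‖thetaTest 4 w₁ x‖ * ‖φ y‖ * C' := by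
                refine mul_le_mul_of_nonneg_left ?_ (by positivity)
                rw [Real.norm_eq_abs]; exact hKC _ (hθfar x y hx hyU)
            _ = C' * (‖thetaTest 4 w₁ x‖ * ‖φ y‖) := by ring
      have hswap := integral_integral_swap hF
      rw [hswap] at hH
      calc ∫ y, φ y • Ψ y = ∫ y, ∫ x, thetaTest 4 w₁ x * φS y * K (y - x) := by
            refine integral_congr_ae (Eventually.of_forall fun y => ?_)
            simp only [hΨ_def, smul_eq_mul, ← integral_const_mul]
            refine integral_congr_ae (Eventually.of_forall fun x => ?_)
            simp only [hφS]; ring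
        _ = 0 := hH
    have hae := hU.ae_eq_zero_of_integral_contDiff_smul_eq_zero
      (hΨc.locallyIntegrableOn hU.measurableSet) hΨint
    have hrestr : Ψ =ᵐ[volume.restrict U] (fun _ => (0 : ℝ)) := by
      rw [Filter.EventuallyEq, ae_restrict_iff' hU.measurableSet]
      filter_upwards [hae] with y hy
      exact hy
    have hEq := Measure.eqOn_open_of_ae_eq hrestr hU hΨc continuousOn_const
    have hΨ0 : ∀ y : EuclideanSpace ℝ (Fin 4), 0 < y 0 → ∫ x, thetaTest 4 w₁ x * K (y - x) = 0 :=
      fun y hy => hEq hy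
    -- STEP B: evaluate at the point `y_v` and change variables
    set e₀ : EuclideanSpace ℝ (Fin 4) := EuclideanSpace.single (0 : Fin 4) (1 : ℝ) with he₀_def
    set yv : EuclideanSpace ℝ (Fin 4) := (1 / 2 : ℝ) • (v - (v 0) • e₀) + τ • e₀ with hyv_def
    have hyv0 : yv 0 = τ := by simp [hyv_def, he₀_def]
    have hin : ∀ u : EuclideanSpace ℝ (Fin 4), 2 * ⟪yv, u⟫ = ⟪v, u⟫ - v 0 * u 0 + 2 * τ * u 0 := by
      intro u
      simp only [hyv_def, he₀_def, inner_add_left, real_inner_smul_left, inner_sub_left,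
        EuclideanSpace.inner_single_left]
      simp; ring
    have h1 := hΨ0 yv (by rw [hyv0]; exact hτ)
    rw [← integral_sub_left_eq_self (fun x => thetaTest 4 w₁ x * K (yv - x)) volume yv] at h1
    have h2 : ∀ u : EuclideanSpace ℝ (Fin 4), thetaTest 4 w₁ (yv - u) * K (yv - (yv - u)) =
        Real.exp (-‖yv‖ ^ 2) * (Real.exp ⟪v, u⟫ * ρ u) := by
      intro u
      rw [sub_sub_cancel, thetaTest_apply, hw₁, LinearIsometryEquiv.norm_map]
      have hA : (timeReflection 4 (yv - u)) 0 = u 0 - τ := by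
        simp [timeReflection_apply, hyv0]; ring
      rw [hA, hg_def, hρ_def]
      simp only
      have hsq : ‖yv - u‖ ^ 2 = ‖yv‖ ^ 2 - 2 * ⟪yv, u⟫ + ‖u‖ ^ 2 := norm_sub_sq_real _ _
      have key : Real.exp (-(2 * τ - v 0) * (u 0 - τ + τ)) * Real.exp (-‖yv - u‖ ^ 2) =
          Real.exp (-‖yv‖ ^ 2) * Real.exp ⟪v, u⟫ * Real.exp (-‖u‖ ^ 2) := by
        rw [← Real.exp_add, ← Real.exp_add, ← Real.exp_add]
        congr 1
        rw [hsq, hin u]; ring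
      calc (b : ℝ → ℝ) (u 0 - τ) * Real.exp (-(2 * τ - v 0) * (u 0 - τ + τ)) *
            Real.exp (-‖yv - u‖ ^ 2) * K u
          = (b : ℝ → ℝ) (u 0 - τ) * K u *
            (Real.exp (-(2 * τ - v 0) * (u 0 - τ + τ)) * Real.exp (-‖yv - u‖ ^ 2)) := by ring
        _ = (b : ℝ → ℝ) (u 0 - τ) * K u *
            (Real.exp (-‖yv‖ ^ 2) * Real.exp ⟪v, u⟫ * Real.exp (-‖u‖ ^ 2)) := by rw [key]
        _ = _ := by ring
    simp_rw [h2] at h1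
    rw [integral_const_mul] at h1
    exact (mul_eq_zero.mp h1).resolve_left (Real.exp_pos _).ne'
  -- CONCLUSION via Laplace injectivity ------------------------------------------------------
  have hρz : ρ z = 0 := eq_zero_of_laplace_eq_zero hρm hρi hlap hρc
  rw [hρ_def] at hρz
  simp only [hb_one, one_mul] at hρz
  exact (mul_eq_zero.mp hρz).resolve_left (Real.exp_pos _).ne'

end Summit.QuantumFields.YangMills.Cruxes.DetectorRigidity

end
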